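import Mathlib
import Summits.ValiantsHypothesis.ValiantsHypothesis.Theorems.BarrierLeverTransversalMinorLayoutsParabolicRelabel

/-!
# Route BarrierLever — parabolic certificates: the hypothesis (P*) of
# `Compression.transversalMinorLayoutsNonsingular_of_nestedRelabelings_of_parabolic` is FALSE

Seat val-np-p1 (cell valiant-natproofs, rung V4; `--supports` item stmt-ValiantsHypothesis-19689
`ParabolicCertificatesExist`).  Planner p1-g11 observed (bus 2026-08-26T16:08Z, exact numerics) that
the split of val-np-p2's parabolic programme into (N*) «nested degree tails exist for some literal
relabelings» and (P*) «nested degree tails for (σ, π) ⇒ a parabolic certificate for (σ, π)» is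
degenerate: (N*) is trivially true and (P*) is false, so the tree theorem
`transversalMinorLayoutsNonsingular_of_nestedRelabelings_of_parabolic : (N*) → (P*) → TT` (p452737)
is vacuous, and only the COMBINED statement GP (item 19689) is a meaningful conjecture.  This file
puts the refutation of (P*) in the kernel.

WITNESS: `h = 2`, `r = 2`, `U = (∅, {1})`, `W = (∅, {0})`, `σ = π = swap 1 2` on `Fin 4`.  All four
members have degree 1 (one literal in the first half), so the degree tails are equal, hence nested;
the relabelled row sets are `(1,3), (1,2)` and the column sets `(1,3), (0,3)`; for EVERY parabolic
`g` (rows `2,3` vanish on columns `0,1`) the pairing matrix is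
`[[g₁₁g₃₃, g₁₀g₃₃], [g₁₁g₂₃, g₁₀g₂₃]]`, of rank ≤ 1.

* `not_parabolicStar` — ¬ (P*), with (P*) spelled VERBATIM as in p452737.

WHAT THIS IS NOT: GP (item 19689: SOME relabeling admits a parabolic certificate) is untouched and
OPEN; nothing here bears on TT, crux 14610 or VP versus VNP.
-/

-- layout Summits/ValiantsHypothesis/ValiantsHypothesis forces the duplicated namespace component
set_option linter.dupNamespace false

namespace Summit.ValiantsHypothesis.ValiantsHypothesis.Theorems.BarrierLever.ParabolicCert

open Matrix Finset

/-- **(P*) is false**: it is NOT the case that for every pair of injective layouts and every pair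
of literal relabelings with nested degree tails some parabolic matrix makes the relabelled pairing
matrix nonsingular.  Witness `h = r = 2`, `U = (∅,{1})`, `W = (∅,{0})`, `σ = π = swap 1 2`. -/
theorem not_parabolicStar :
    ¬ (∀ (h r : ℕ) (U W : Fin r → Finset (Fin h)) (σ π : Equiv.Perm (Fin (h + h))),
      Function.Injective U → Function.Injective W →
      (∀ t : ℕ, (Finset.univ.filter fun j => t ≤ (Finset.univ.filter fun b : Fin h =>
            (π (if b ∈ W j then Fin.castAdd h b else Fin.natAdd h b)).val < h).card).card ≤
          (Finset.univ.filter fun i => t ≤ (Finset.univ.filter fun b : Fin h =>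
            (σ (if b ∈ U i then Fin.castAdd h b else Fin.natAdd h b)).val < h).card).card) →
      ∃ g : Matrix (Fin (h + h)) (Fin (h + h)) ℂ,
        (∀ a c : Fin h, g (Fin.natAdd h a) (Fin.castAdd h c) = 0) ∧
        (Matrix.of fun i j : Fin r => (g.submatrix
          (fun b : Fin h => σ (if b ∈ U i then Fin.castAdd h b else Fin.natAdd h b))
          (fun b : Fin h => π (if b ∈ W j then Fin.castAdd h b else Fin.natAdd h b))).det).det
          ≠ 0) := by
  intro P
  -- the witness
  have hU : Function.Injective (![∅, {1}] : Fin 2 → Finset (Fin 2)) := by decide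
  have hW : Function.Injective (![∅, {0}] : Fin 2 → Finset (Fin 2)) := by decide
  -- all four members have degree 1, so the degree tails coincide
  have hWd : ∀ j : Fin 2, (Finset.univ.filter fun b : Fin 2 =>
      ((Equiv.swap (1 : Fin (2 + 2)) 2) (if b ∈ (![∅, {0}] : Fin 2 → Finset (Fin 2)) j then
        Fin.castAdd 2 b else Fin.natAdd 2 b)).val < 2).card = 1 := by decide
  have hUd : ∀ i : Fin 2, (Finset.univ.filter fun b : Fin 2 =>
      ((Equiv.swap (1 : Fin (2 + 2)) 2) (if b ∈ (![∅, {1}] : Fin 2 → Finset (Fin 2)) i then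
        Fin.castAdd 2 b else Fin.natAdd 2 b)).val < 2).card = 1 := by decide
  obtain ⟨g, hpar, hdet⟩ := P 2 2 ![∅, {1}] ![∅, {0}] (Equiv.swap 1 2) (Equiv.swap 1 2) hU hW
    (by intro t; simp only [hWd, hUd, le_refl])
  apply hdet
  -- the four relabelled literal maps, evaluated
  have e2 : (Equiv.swap (1 : Fin (2 + 2)) 2) 2 = 1 := by decide
  have e1 : (Equiv.swap (1 : Fin (2 + 2)) 2) 1 = 2 := by decide
  have e3 : (Equiv.swap (1 : Fin (2 + 2)) 2) 3 = 3 := by decide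
  have e0 : (Equiv.swap (1 : Fin (2 + 2)) 2) 0 = 0 := by decide
  have z20 : g 2 0 = 0 := hpar 0 0
  have z21 : g 2 1 = 0 := hpar 0 1
  have z30 : g 3 0 = 0 := hpar 1 0
  have z31 : g 3 1 = 0 := hpar 1 1
  rw [Matrix.det_fin_two]
  simp only [Matrix.of_apply, Matrix.det_fin_two, Matrix.submatrix_apply]
  simp [Fin.castAdd, Fin.natAdd, e0, e1, e2, e3, z20, z21, z30, z31]
  ring

end Summit.ValiantsHypothesis.ValiantsHypothesis.Theorems.BarrierLever.ParabolicCert
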